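import Summits.AtomisticToContinuum.BoseEinsteinCondensation.Theorems.BECThomsonPrincipleGDTransferSeededCountLaw
import Summits.AtomisticToContinuum.BoseEinsteinCondensation.Theorems.BECInsertionCorrectorCorrectorClosureVolumeBootstrap

/-!
# Route `BECThomsonPrinciple`, crux `GDTransfer` (stmt-AtomisticToContinuum-9482), line `seeded-continuity`:
# stub `stub_projectedDichotomy`, part X1 — band emptiness in the EMPTY-WINDOW corner (no Gaussian domination)

Support file of the registered stub `stub_projectedDichotomy : Sig.stub_projectedDichotomy`
(`GaussianDominationCan → ∀ v soft, BandEmptiness v`, `Theorems/BECThomsonPrincipleGDTransferSeededDefs.lean`).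
The GD-free corner of the `(N, L)`-regime: when the Gaussian-domination window `{p ≠ 0 : 2π‖p‖/L ≤ M√ρ}`
(`Negative.InWindow`) is EMPTY, i.e. `M√ρ·L < 2π` (`ρ = N/L³`; equivalently `L > M²N/4π²`, `Negative.side_le_of_inWindow`),
every non-zero mode has `|2πp/L|² ≥ 4π²/L² > M²ρ`, so the kinetic tail alone bounds ALL depletion of a near-minimiser:
`N − ⟨n̂₀⟩ ≤ (L/2π)²·∫|∇Ψ|²` (`vb_depletion_le`: Parseval + kinetic Chebyshev) `≤ E(Ψ)/(M²ρ) ≤ (16πR + 1)N/M²` by Dyson's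
upper bound `E₀ ≤ 16πRρN` (`dud_groundStateEnergy_le`, `R` a range radius of `v`, `N ≥ 2`, `L > 4R`, `ρ` small) at slack
`δ = ρN`.  Markov on the `n̂₀`-law (the COUNT LAW `stub_countLaw`, landed: `Σ_S w_S = 1`, `Σ_S |S| w_S = ⟨n̂₀⟩`, so
`Σ_S (N − |S|) w_S = N − ⟨n̂₀⟩`): on the band `|S| < (1−β)N` one has `βN < N − |S|`, hence
`βN · bandMass ≤ N − ⟨n̂₀⟩` and `bandMass ≤ (16πR+1)/(βM²)`, uniformly in `θ`, `N ≥ 2` and `L` with `N ≤ ρ₀L³`.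
(In the main assembly of the stub the window sum simply vanishes in this corner; this file certifies the corner and the
sharper `1/β` constant.)  [folklore] (LSSY2005 Thm 2.2 (2.14), App. A (A.6)–(A.11)).
-/

noncomputable section

open MeasureTheory Filter
open scoped ENNReal NNReal

namespace Summit.AtomisticToContinuum.BoseEinsteinCondensation.Cruxes.GDTransfer.Seeded

namespace EmptyWindow

open Literature.MathematicalPhysics.QuantumManyBody.BoseGas
open Summit.AtomisticToContinuum.BoseEinsteinCondensation.Theorems.CorrectorClosure.VolumeHomotopySumRuleDomination
  (vb_depletion_le dud_groundStateEnergy_le)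

variable {m : ℕ} {L : ℝ}

/-- **Markov on the law**: `βN · P(θN ≤ n̂₀ < (1−β)N) ≤ Σ_S (N − |S|) w_S` (on the band `βN < N − |S|`). [folklore] -/
theorem ofReal_mul_bandMass_le (L θ β : ℝ) (ψ : Config (m + 1) → ℂ) :
    ENNReal.ofReal (β * (m + 1)) * bandMass m L θ β ψ ≤
      ∑ S : Finset (Fin (m + 1)), ((m + 1 - S.card : ℕ) : ℝ≥0∞) * compMass m L S ψ := by
  unfold bandMass lawMass
  rw [Finset.mul_sum]
  calc ∑ S ∈ (Finset.univ : Finset (Finset (Fin (m + 1)))).filter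
          (fun S => θ * (m + 1) ≤ (S.card : ℝ) ∧ (S.card : ℝ) < (1 - β) * (m + 1)),
          ENNReal.ofReal (β * (m + 1)) * compMass m L S ψ
      ≤ ∑ S ∈ (Finset.univ : Finset (Finset (Fin (m + 1)))).filter
          (fun S => θ * (m + 1) ≤ (S.card : ℝ) ∧ (S.card : ℝ) < (1 - β) * (m + 1)),
          ((m + 1 - S.card : ℕ) : ℝ≥0∞) * compMass m L S ψ := by
        refine Finset.sum_le_sum fun S hS => ?_
        obtain ⟨-, h2⟩ := (Finset.mem_filter.1 hS).2
        have hcard : S.card ≤ m + 1 := by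
          simpa only [Fintype.card_fin] using S.card_le_univ
        have hle : β * (m + 1) ≤ ((m + 1 - S.card : ℕ) : ℝ) := by
          rw [Nat.cast_sub hcard]
          push_cast
          linarith
        have hle' : ENNReal.ofReal (β * (m + 1)) ≤ ((m + 1 - S.card : ℕ) : ℝ≥0∞) :=
          (ENNReal.ofReal_le_ofReal hle).trans_eq (ENNReal.ofReal_natCast _)
        exact mul_le_mul' hle' le_rfl
    _ ≤ ∑ S : Finset (Fin (m + 1)), ((m + 1 - S.card : ℕ) : ℝ≥0∞) * compMass m L S ψ :=
        Finset.sum_le_sum_of_subset_of_nonneg (Finset.filter_subset _ _) fun _ _ _ => zero_le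

/-- **Depletion through the law**: `Σ_S (N − |S|) w_S(Ψ) = N − ⟨Ψ, n̂₀Ψ⟩` for a periodic trial state (the count law
`Σ_S w_S = 1`, `Σ_S |S| w_S = ⟨n̂₀⟩`). [folklore] -/
theorem sum_sub_card_mul_compMass (hL : 0 < L) (Ψ : PeriodicTrialState (m + 1) L) :
    ∑ S : Finset (Fin (m + 1)), ((m + 1 - S.card : ℕ) : ℝ≥0∞) * compMass m L S Ψ.ψ =
      ((m + 1 : ℕ) : ℝ≥0∞) - condensateOccupation (m + 1) L Ψ.ψ := by
  have h1 := sum_compMass_trialState hL Ψ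
  have h2 := sum_card_mul_compMass_trialState hL Ψ
  have hsum : ∑ S : Finset (Fin (m + 1)), ((m + 1 - S.card : ℕ) : ℝ≥0∞) * compMass m L S Ψ.ψ +
      ∑ S : Finset (Fin (m + 1)), (S.card : ℝ≥0∞) * compMass m L S Ψ.ψ = ((m + 1 : ℕ) : ℝ≥0∞) := by
    rw [← Finset.sum_add_distrib]
    calc ∑ S : Finset (Fin (m + 1)), (((m + 1 - S.card : ℕ) : ℝ≥0∞) * compMass m L S Ψ.ψ +
          (S.card : ℝ≥0∞) * compMass m L S Ψ.ψ)
        = ∑ S : Finset (Fin (m + 1)), ((m + 1 : ℕ) : ℝ≥0∞) * compMass m L S Ψ.ψ := by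
          refine Finset.sum_congr rfl fun S _ => ?_
          have hcard : S.card ≤ m + 1 := by
            simpa only [Fintype.card_fin] using S.card_le_univ
          rw [← add_mul, ← Nat.cast_add, Nat.sub_add_cancel hcard]
      _ = ((m + 1 : ℕ) : ℝ≥0∞) := by rw [← Finset.mul_sum, h1, mul_one]
  rw [h2] at hsum
  have hfin : condensateOccupation (m + 1) L Ψ.ψ ≠ ⊤ :=
    ne_top_of_le_ne_top (ENNReal.natCast_ne_top (m + 1)) (by rw [← hsum]; exact le_add_self)
  exact ENNReal.eq_sub_of_add_eq hfin hsum

end EmptyWindow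

open Literature.MathematicalPhysics.QuantumManyBody.BoseGas
open Summit.AtomisticToContinuum.BoseEinsteinCondensation.Theorems.CorrectorClosure.VolumeHomotopySumRuleDomination
  (vb_depletion_le dud_groundStateEnergy_le)
open EmptyWindow

/-- **Band emptiness in the empty-window corner, without Gaussian domination** (part X1 of `stub_projectedDichotomy`):
for every repulsive finite-range `v` there are `A = 16πR + 1` (`R` a range radius) and `ρ₀ > 0` such that for every
`N = m + 1 ≥ 2`, every side `L > 0` with `N ≤ ρ₀L³`, every window parameter `M > 0` whose window is EMPTY
(`M√(N/L³)·L < 2π`), every `β > 0`, every `(ρN)`-near-minimiser `Ψ` (`ρ = N/L³`) and every `θ`: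
`bandMass m L θ β Ψ ≤ A/(βM²)` — Dyson's bound, kinetic Chebyshev off the (empty) window and Markov on the count law.
[folklore] (LSSY2005 Thm 2.2 (2.14); App. A (A.6)–(A.11)) -/
theorem bandMass_le_of_emptyWindow :
    ∀ v : ℝ → ℝ≥0∞, Literature.MathematicalPhysics.QuantumManyBody.BoseGas.IsRepulsiveFiniteRange v →
      ∃ A : ℝ, 0 < A ∧ ∃ ρ₀ : ℝ, 0 < ρ₀ ∧ ∀ m : ℕ, 1 ≤ m → ∀ L : ℝ, 0 < L → ((m + 1 : ℕ) : ℝ) ≤ ρ₀ * L ^ 3 →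
        ∀ M β : ℝ, 0 < M → 0 < β → M * Real.sqrt (((m + 1 : ℕ) : ℝ) / L ^ 3) * L < 2 * Real.pi →
          ∀ Ψ : Literature.MathematicalPhysics.QuantumManyBody.BoseGas.PeriodicTrialState (m + 1) L,
            Literature.MathematicalPhysics.QuantumManyBody.BoseGas.periodicEnergy v Ψ ≤
                Literature.MathematicalPhysics.QuantumManyBody.BoseGas.periodicGroundStateEnergy v (m + 1) L +
                  ENNReal.ofReal (((m + 1 : ℕ) : ℝ) / L ^ 3 * (m + 1)) →
              ∀ θ : ℝ, bandMass m L θ β Ψ.ψ ≤ ENNReal.ofReal (A / (β * M ^ 2)) := by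
  intro v hv
  obtain ⟨R, hR, hvR⟩ := hv.exists_pos_range
  obtain ⟨ρ₁, hρ₁, hD⟩ := dud_groundStateEnergy_le hR
  refine ⟨16 * Real.pi * R + 1, by positivity, min (ρ₁ / 2) (2 / (4 * R + 1) ^ 3),
    lt_min (by positivity) (by positivity), ?_⟩
  intro m hm L hL hNL M β hM hβ hwin Ψ hΨ θ
  set N : ℝ := ((m + 1 : ℕ) : ℝ) with hN
  have hN2 : (2 : ℝ) ≤ N := by
    rw [hN]
    exact_mod_cast (by omega : 2 ≤ m + 1)
  have hNpos : 0 < N := by linarith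
  have hNm : N = (m : ℝ) + 1 := by rw [hN]; push_cast; ring
  have hL3 : 0 < L ^ 3 := by positivity
  set ρ : ℝ := N / L ^ 3 with hρ
  have hρpos : 0 < ρ := div_pos hNpos hL3
  have hρle : ρ ≤ min (ρ₁ / 2) (2 / (4 * R + 1) ^ 3) := by
    rw [hρ, div_le_iff₀ hL3]
    exact hNL
  have hρ₁' : ρ < ρ₁ := by
    have := hρle.trans (min_le_left _ _)
    linarith
  -- the side is large: `4R < L`
  have hL4 : 4 * R < L := by
    have h1 : N ≤ 2 / (4 * R + 1) ^ 3 * L ^ 3 :=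
      hNL.trans (mul_le_mul_of_nonneg_right (min_le_right _ _) hL3.le)
    have h3 : (2 : ℝ) ≤ 2 / (4 * R + 1) ^ 3 * L ^ 3 := hN2.trans h1
    rw [div_mul_eq_mul_div, le_div_iff₀ (by positivity)] at h3
    have h2 : (4 * R + 1) ^ 3 ≤ L ^ 3 := by nlinarith
    have h4 : 4 * R + 1 ≤ L := le_of_pow_le_pow_left₀ three_ne_zero hL.le h2
    linarith
  -- Dyson's bound and the energy of the near-minimiser
  have hE0 : periodicGroundStateEnergy v (m + 1) L ≤ ENNReal.ofReal (16 * Real.pi * R * ρ * N) :=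
    hD (m + 1) (by omega) L hL4 hρ₁' v hvR
  set A : ℝ := 16 * Real.pi * R + 1 with hA
  have hEΨ : periodicEnergy v Ψ ≤ ENNReal.ofReal (A * ρ * N) := by
    calc periodicEnergy v Ψ
        ≤ periodicGroundStateEnergy v (m + 1) L + ENNReal.ofReal (ρ * ((m : ℝ) + 1)) := hΨ
      _ = periodicGroundStateEnergy v (m + 1) L + ENNReal.ofReal (ρ * N) := by rw [hNm]
      _ ≤ ENNReal.ofReal (16 * Real.pi * R * ρ * N) + ENNReal.ofReal (ρ * N) := add_le_add hE0 le_rfl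
      _ = ENNReal.ofReal (A * ρ * N) := by
          rw [← ENNReal.ofReal_add (by positivity) (by positivity), hA]
          congr 1
          ring
  -- the window is empty: `(L/2π)² · AρN ≤ AN/M²`
  have hkey : M ^ 2 * ρ * L ^ 2 < (2 * Real.pi) ^ 2 := by
    have h := pow_lt_pow_left₀ hwin (by positivity) two_ne_zero
    rw [mul_pow, mul_pow, Real.sq_sqrt hρpos.le] at h
    linarith
  have htail : (L / (2 * Real.pi)) ^ 2 * (A * ρ * N) ≤ A * N / M ^ 2 := by
    rw [le_div_iff₀ (by positivity), div_pow]
    have hfrac : M ^ 2 * ρ * L ^ 2 / (2 * Real.pi) ^ 2 ≤ 1 := by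
      rw [div_le_one (by positivity)]
      exact hkey.le
    calc L ^ 2 / (2 * Real.pi) ^ 2 * (A * ρ * N) * M ^ 2
        = A * N * (M ^ 2 * ρ * L ^ 2 / (2 * Real.pi) ^ 2) := by ring
      _ ≤ A * N * 1 := by gcongr
      _ = A * N := mul_one _
  -- the depletion of the near-minimiser
  have hdep : ((m + 1 : ℕ) : ℝ≥0∞) - condensateOccupation (m + 1) L Ψ.ψ ≤ ENNReal.ofReal (A * N / M ^ 2) := by
    calc ((m + 1 : ℕ) : ℝ≥0∞) - condensateOccupation (m + 1) L Ψ.ψ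
        ≤ ENNReal.ofReal ((L / (2 * Real.pi)) ^ 2) * ∫⁻ X in cellN (m + 1) L, kineticDensity Ψ.ψ X :=
          vb_depletion_le hL Ψ
      _ ≤ ENNReal.ofReal ((L / (2 * Real.pi)) ^ 2) * periodicEnergy v Ψ :=
          mul_le_mul' le_rfl (lintegral_mono fun _ => le_self_add)
      _ ≤ ENNReal.ofReal ((L / (2 * Real.pi)) ^ 2) * ENNReal.ofReal (A * ρ * N) := mul_le_mul' le_rfl hEΨ
      _ = ENNReal.ofReal ((L / (2 * Real.pi)) ^ 2 * (A * ρ * N)) := (ENNReal.ofReal_mul (sq_nonneg _)).symm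
      _ ≤ ENNReal.ofReal (A * N / M ^ 2) := ENNReal.ofReal_le_ofReal htail
  -- Markov on the count law
  have hMarkov : ENNReal.ofReal (β * N) * bandMass m L θ β Ψ.ψ ≤ ENNReal.ofReal (A * N / M ^ 2) := by
    calc ENNReal.ofReal (β * N) * bandMass m L θ β Ψ.ψ
        ≤ ∑ S : Finset (Fin (m + 1)), ((m + 1 - S.card : ℕ) : ℝ≥0∞) * compMass m L S Ψ.ψ := by
          rw [hNm]; exact ofReal_mul_bandMass_le L θ β Ψ.ψ
      _ = ((m + 1 : ℕ) : ℝ≥0∞) - condensateOccupation (m + 1) L Ψ.ψ := sum_sub_card_mul_compMass hL Ψ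
      _ ≤ ENNReal.ofReal (A * N / M ^ 2) := hdep
  have hβN : 0 < β * N := mul_pos hβ hNpos
  calc bandMass m L θ β Ψ.ψ
      ≤ ENNReal.ofReal (A * N / M ^ 2) / ENNReal.ofReal (β * N) := by
        rw [ENNReal.le_div_iff_mul_le (Or.inl (ENNReal.ofReal_pos.2 hβN).ne')
          (Or.inl ENNReal.ofReal_ne_top), mul_comm]
        exact hMarkov
    _ = ENNReal.ofReal (A * N / M ^ 2 / (β * N)) := (ENNReal.ofReal_div_of_pos hβN).symm
    _ = ENNReal.ofReal (A / (β * M ^ 2)) := by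
        congr 1
        field_simp

end Summit.AtomisticToContinuum.BoseEinsteinCondensation.Cruxes.GDTransfer.Seeded

end
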